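import Literature.AnabelianGeometry.EtaleTheta.RealificationFunctorWeak
import Literature.AnabelianGeometry.EtaleTheta.Discharge.Sec3Remark364Weak
import Literature.AnabelianGeometry.EtaleTheta.Discharge.Sec3Lemma35HoldsWeak
import Literature.AnabelianGeometry.EtaleTheta.PerfectionPrimes
import Literature.AnabelianGeometry.EtaleTheta.MonoprimeStructure
import Literature.AlgebraicGeometry.Frobenioids.PiNatMonoid
import Literature.AlgebraicGeometry.Frobenioids.ArithmeticDivisorsPerfFactorial
import HarnessLib

/-!
# The image of `M^pf` in the WEAK realification `M^rlf`, and the coordinates of `(∏_J ℤ_{≥0})^rlf`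

Mochizuki, *The geometry of Frobenioids I*, Kyushu J. Math. **62** (2008), Def. 2.4 (i) pp. 47–48 (`M^pf ⊆ M^rlf`,
the factorization homomorphism; "`M^pf` … [is] also perf-factorial") [cite: MochizukiFrdI2008, Def. 2.4(i) p.47];
Mochizuki, *The étale theta function …*, Publ. RIMS **45** (2009), Prop. 3.2 (i) p.70 (`DIV⁺` of the special fibre
of `Z_∞^log` is `∏` over the irreducible components), Def. 3.6 (ii) p.76 ("`Φ ⊆ Φ^{ℝ-log}` … group-saturated …
perf-factorial"), Lemma 3.5 p.75 [cite: MochizukiEtTh2009, Def 3.6 p.76].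

abc-iut cell, layer L2, seat abc-iut-L2-d2 (gen 4); proof-only LEMMA file for the non-vacuity witness of [EtTh]
Def. 3.6 (ii) over the WEAK monoid vocabulary at INFINITELY many special-fibre components (L2-lead gen 4 R227).
Weak-hypothesis twins of abc-iut-w5-d164's `Example39NV` lemmas (`Sec3Example39DataNonVacuity.lean`), and the
coordinate calculus of `(∏_J ℤ_{≥0})^rlf` through the weak universal property of the realification
(`RlfUniversalWeak`, this seat gen 3):

* `PfImageWeak.toRealification_injective`, `mrangeRestrict_toRealification_bijective`,
  `isGroupSaturated_mrange_toRealification` (order embedding `M^pf ↪ M^rlf`, `RlfCoordWeak.toRealification_dvd_iff`),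
  `isPerfFactorialCof_mrange_toRealification` (`≅ M^pf`, `IsPerfFactorialCof.perfection`) — print's "`Φ_W` := the
  image of `Φ₀^pf`" IS a legitimate `Φ` in Def. 3.6 (ii) for every weakly perf-factorial `Φ₀(Y)` with cofinal
  perfection;
* for `M = ∏_J ℤ_{≥0}`: `PiNatRlfWeak.exists_coordRlf j` — the `j`-th coordinate `M^rlf → (ℤ_{≥0})^rlf` over
  `pr_j^pf` (functoriality of `M ↦ M^rlf`, [FrdI] Prop. 5.3), `mem_mrange_map_powersHom_of_forall_eq` — an element of
  `M^pf` all of whose coordinates agree is a root of a power of the diagonal `d = (1, 1, …)` ("the special fibre"),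
  `map_powersHom_injective`, `isMonoprime_mrange_toRealification_comp_map_powersHom` — the diagonal image
  `ι(⟨d⟩^pf) ⊆ M^rlf` is monoprime (`≅ (ℤ_{≥0})^pf ≅ ℚ_{≥0}`).

No definitions; nothing of either paper is restated.  HONEST FRAMING: elementary monoid algebra for a consistency
witness; nothing here bears on [IUTchIII] Cor. 3.12.
-/

namespace Literature.AnabelianGeometry.EtaleTheta

open Literature.AlgebraicGeometry.Frobenioids Function

universe w

/-! ### The image of `M^pf` in `M^rlf` for WEAKLY perf-factorial `M` -/

namespace PfImageWeak

variable {M : Type w} [CommMonoid M]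

/-- `M^pf → M^rlf` is injective for a weakly perf-factorial `M` (the factorization homomorphism is injective,
[FrdI] Def. 2.4 (i)(c)). [cite: MochizukiFrdI2008, Def. 2.4(i) p.47] -/
theorem toRealification_injective (hM : IsPerfFactorialWeak M) : Injective hM.toRealification :=
  fun _ _ h => hM.factorMap_injective (congrArg Subtype.val h)

/-- `M^pf ≅` its image in `M^rlf` (bijectivity of the range restriction), weak hypothesis.
[cite: MochizukiFrdI2008, Def. 2.4(i) p.48] -/
theorem mrangeRestrict_toRealification_bijective (hM : IsPerfFactorialWeak M) :
    Bijective hM.toRealification.mrangeRestrict :=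
  ⟨fun _ _ h => toRealification_injective hM (congrArg Subtype.val h), MonoidHom.mrangeRestrict_surjective _⟩

/-- **The image of `M^pf` in `M^rlf` is group-saturated** ([EtTh] §0 p. 8) for every WEAKLY perf-factorial `M`:
if `q · b = a` in `M^rlf` with `a, b ∈ M^pf`, then `b ≤ a` in `M^rlf`, hence in `M^pf` (the order embedding
`M^pf ↪ M^rlf` from (d_ord), `RlfCoordWeak.toRealification_dvd_iff`, this seat gen 3), so `q = a/b ∈ M^pf` by
cancellation in `M^rlf` (`IsPerfFactorialWeak.Rlf.isCancelMul`). [cite: MochizukiEtTh2009, Lem 3.5 p.76] -/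
theorem isGroupSaturated_mrange_toRealification (hM : IsPerfFactorialWeak M) :
    IsGroupSaturated (MonoidHom.mrange hM.toRealification) := by
  rw [isGroupSaturated_iff']
  rintro q _ ⟨a, rfl⟩ _ ⟨b, rfl⟩ h
  have hdvd : hM.toRealification b ∣ hM.toRealification a := ⟨q, by rw [mul_comm, h]⟩
  obtain ⟨c, hc⟩ :=
    (RlfCoordWeak.toRealification_dvd_iff hM (RlfCoordWeak.isMonoprime_pfAt hM) b a).mp hdvd
  haveI := IsPerfFactorialWeak.Rlf.isCancelMul hM
  refine ⟨c, ?_⟩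
  have h' : q * hM.toRealification b = hM.toRealification c * hM.toRealification b := by
    rw [h, hc, map_mul, mul_comm]
  exact (mul_right_cancel h').symm

/-- **The image of `M^pf` in `M^rlf` is "perf-factorial" in the weak vocabulary** (`IsPerfFactorialCof`: it is
`≅ M^pf`, and `M^pf` is weakly perf-factorial with cofinal perfection when `M` is, `IsPerfFactorialCof.perfection`).
[cite: MochizukiFrdI2008, Def. 2.4(i) p.48] -/
theorem isPerfFactorialCof_mrange_toRealification (hM : IsPerfFactorialCof M) :
    IsPerfFactorialCof (MonoidHom.mrange hM.weak.toRealification) :=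
  hM.perfection.of_mulEquiv (MulEquiv.ofBijective _ (mrangeRestrict_toRealification_bijective hM.weak))

/-- Hence the image of `M^pf` in `M^rlf` is divisorial ([FrdI] Def. 2.4 (i)(a)).
[cite: MochizukiFrdI2008, Def. 2.4(i) p.47] -/
theorem isDivisorial_mrange_toRealification (hM : IsPerfFactorialCof M) :
    IsDivisorial (MonoidHom.mrange hM.weak.toRealification) :=
  (isPerfFactorialCof_mrange_toRealification hM).weak.isDivisorial

end PfImageWeak

/-! ### Coordinates of `(∏_J ℤ_{≥0})^rlf` and the diagonal -/

namespace PiNatRlfWeak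

variable {J : Type}

/-- `ℤ_{≥0}` is weakly perf-factorial (monoprime ⟹ perf-factorial ⟹ weakly so).
[cite: MochizukiFrdI2008, Def. 2.4(i) p.47] -/
theorem natWeak : IsPerfFactorialWeak (Multiplicative ℕ) :=
  (MonoprimeStructure.isPerfFactorial isMonoprime_multiplicative_nat).weak

/-- **The `j`-th coordinate of `(∏_J ℤ_{≥0})^rlf`**: a homomorphism `(∏_J ℤ_{≥0})^rlf → (ℤ_{≥0})^rlf` lying
over `pr_j^pf : (∏_J ℤ_{≥0})^pf → (ℤ_{≥0})^pf` (functoriality of the weak realification, [FrdI] Prop. 5.3 /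
`RlfUniversalWeak.existsUnique_map`: the source has cofinal perfection, `ℝ` supports the target).
[cite: MochizukiFrdI2008, Prop. 5.3 p.103] -/
theorem exists_coordRlf (hM : IsPerfFactorialCof (Multiplicative (J → ℕ))) (j : J) :
    ∃ φ : hM.weak.Rlf →* natWeak.Rlf,
      φ.comp hM.weak.toRealification =
        natWeak.toRealification.comp
          (Perfection.map (AddMonoidHom.toMultiplicative (Pi.evalAddMonoidHom (fun _ : J => ℕ) j))) :=
  (RlfUniversalWeak.existsUnique_map hM.weak hM.rlfCofinal natWeak natWeak.supports_rlf_R _).exists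

/-- The coordinate, on elements of the image of `M^pf`. [cite: MochizukiFrdI2008, Prop. 5.3 p.103] -/
theorem coordRlf_apply_toRealification (hM : IsPerfFactorialCof (Multiplicative (J → ℕ))) {j : J}
    {φ : hM.weak.Rlf →* natWeak.Rlf}
    (hφ : φ.comp hM.weak.toRealification =
      natWeak.toRealification.comp
        (Perfection.map (AddMonoidHom.toMultiplicative (Pi.evalAddMonoidHom (fun _ : J => ℕ) j))))
    (a : Perfection (Multiplicative (J → ℕ))) :
    φ (hM.weak.toRealification a) =
      natWeak.toRealification
        (Perfection.map (AddMonoidHom.toMultiplicative (Pi.evalAddMonoidHom (fun _ : J => ℕ) j)) a) := by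
  have h := DFunLike.congr_fun hφ a
  rwa [MonoidHom.comp_apply, MonoidHom.comp_apply] at h

/-- The `j`-th coordinate of a power `d^c` of the diagonal `d = (1, 1, …)` is `c`.
[cite: MochizukiEtTh2009, Prop 3.2 p.70] -/
theorem eval_diag_pow (j : J) (c : ℕ) :
    AddMonoidHom.toMultiplicative (Pi.evalAddMonoidHom (fun _ : J => ℕ) j)
      ((Multiplicative.ofAdd fun _ : J => (1 : ℕ)) ^ c) = Multiplicative.ofAdd c := by
  change Multiplicative.ofAdd (Multiplicative.toAdd ((Multiplicative.ofAdd fun _ : J => (1 : ℕ)) ^ c) j) = _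
  rw [toAdd_pow, toAdd_ofAdd, Pi.smul_apply, smul_eq_mul, mul_one]

/-- **An element of `(∏_J ℤ_{≥0})^pf` all of whose coordinates agree is (a root of) a power of the diagonal
`d = (1, 1, …)`**: it lies in the image of `⟨d⟩^pf → (∏_J ℤ_{≥0})^pf`. [cite: MochizukiEtTh2009, Prop 3.2 p.70] -/
theorem mem_mrange_map_powersHom_of_forall_eq (j₀ : J) (a : Perfection (Multiplicative (J → ℕ)))
    (h : ∀ j : J,
      Perfection.map (AddMonoidHom.toMultiplicative (Pi.evalAddMonoidHom (fun _ : J => ℕ) j)) a =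
        Perfection.map (AddMonoidHom.toMultiplicative (Pi.evalAddMonoidHom (fun _ : J => ℕ) j₀)) a) :
    a ∈ MonoidHom.mrange (Perfection.map
      (powersHom (Multiplicative (J → ℕ)) (Multiplicative.ofAdd fun _ : J => (1 : ℕ)))) := by
  obtain ⟨⟨m, n⟩, rfl⟩ := Perfection.mk_surjective a
  -- every coordinate of `m` equals its `j₀`-th coordinate
  have hcoord : ∀ j : J, Multiplicative.toAdd m j = Multiplicative.toAdd m j₀ := by
    intro j
    have hj := h j
    simp only [Perfection.map_mk] at hj
    obtain ⟨N, hN⟩ := Perfection.mk_eq_mk_iff.mp hj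
    have hN' := congrArg Multiplicative.toAdd hN
    simp only [toAdd_pow, smul_eq_mul] at hN'
    change (N : ℕ) * (n : ℕ) * Multiplicative.toAdd m j = (N : ℕ) * (n : ℕ) * Multiplicative.toAdd m j₀ at hN'
    exact Nat.eq_of_mul_eq_mul_left (Nat.mul_pos N.pos n.pos) hN'
  have hm : m = (Multiplicative.ofAdd fun _ : J => (1 : ℕ)) ^ Multiplicative.toAdd m j₀ := by
    apply Multiplicative.toAdd.injective
    funext j
    rw [toAdd_pow, toAdd_ofAdd, Pi.smul_apply, smul_eq_mul, mul_one]
    exact hcoord j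
  refine ⟨Perfection.mk (Multiplicative.ofAdd (Multiplicative.toAdd m j₀)) n, ?_⟩
  rw [Perfection.map_mk, powersHom_apply, toAdd_ofAdd, ← hm]

/-- `⟨d⟩^pf → (∏_J ℤ_{≥0})^pf` is injective (`J` non-empty). [cite: MochizukiEtTh2009, Prop 3.2 p.70] -/
theorem map_powersHom_injective (j₀ : J) :
    Injective (Perfection.map
      (powersHom (Multiplicative (J → ℕ)) (Multiplicative.ofAdd fun _ : J => (1 : ℕ)))) := by
  intro x y hxy
  obtain ⟨⟨c, n⟩, rfl⟩ := Perfection.mk_surjective x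
  obtain ⟨⟨c', n'⟩, rfl⟩ := Perfection.mk_surjective y
  simp only [Perfection.map_mk, powersHom_apply] at hxy
  obtain ⟨N, hN⟩ := Perfection.mk_eq_mk_iff.mp hxy
  -- read the relation at the coordinate `j₀`
  have hN' := congrArg (fun f : Multiplicative (J → ℕ) => Multiplicative.toAdd f j₀) hN
  simp only [← pow_mul, toAdd_pow, toAdd_ofAdd, Pi.smul_apply, smul_eq_mul, mul_one] at hN'
  change Perfection.mk c n = Perfection.mk c' n'
  refine Perfection.mk_eq_mk_iff.mpr ⟨N, ?_⟩
  apply Multiplicative.toAdd.injective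
  simp only [toAdd_pow, smul_eq_mul]
  -- `hN'` : toAdd c * (N * n') = toAdd c' * (N * n)
  rw [mul_comm, hN', mul_comm]

/-- **The diagonal image `ι(⟨d⟩^pf) ⊆ (∏_J ℤ_{≥0})^rlf` is monoprime** (`≅ (ℤ_{≥0})^pf ≅ ℚ_{≥0}`:
`PerfectionPrimes.isMonoprime_perfection`), for the weak realification `ι : M^pf → M^rlf` of `M = ∏_J ℤ_{≥0}`.
[cite: MochizukiEtTh2009, Def 3.6 p.77] -/
theorem isMonoprime_mrange_toRealification_comp_map_powersHom (hM : IsPerfFactorialCof (Multiplicative (J → ℕ)))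
    (j₀ : J) :
    IsMonoprime (MonoidHom.mrange (hM.weak.toRealification.comp (Perfection.map
      (powersHom (Multiplicative (J → ℕ)) (Multiplicative.ofAdd fun _ : J => (1 : ℕ)))))) := by
  have hinj : Injective (hM.weak.toRealification.comp (Perfection.map
      (powersHom (Multiplicative (J → ℕ)) (Multiplicative.ofAdd fun _ : J => (1 : ℕ))))) :=
    (PfImageWeak.toRealification_injective hM.weak).comp (map_powersHom_injective j₀)
  exact IsMonoprime.of_mulEquiv
    (MulEquiv.ofBijective _ ⟨fun _ _ h => hinj (congrArg Subtype.val h), MonoidHom.mrangeRestrict_surjective _⟩)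
    (PerfectionPrimes.isMonoprime_perfection isMonoprime_multiplicative_nat)

end PiNatRlfWeak

end Literature.AnabelianGeometry.EtaleTheta
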